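import Summits.AtomisticToContinuum.Crystallization.Theorems.FrustratedLawDichotomyCellKitX
import Summits.AtomisticToContinuum.Crystallization.Theorems.FrustratedLawDichotomyCellCheckerSound

/-!
# FrustratedLawDichotomy · crux `AperiodicFrustratedLawGap` (stmt-AtomisticToContinuum-27623) — CELL KIT X, SOUNDNESS I: the local set of the
# exemption predicates at a class centre, the sum bridge, and ★ `checkRemoval = true ⟹ ¬RemovalUnstableCore` (decomp-a2c, hand 2, g17)

For a rational cell `c` (hand-1's `…CellChecker.Cell`) with geometry check passed and class centre `j = cellIdx m` of the supercell motif `c.zM`: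
* §1 `mem_localSet_iff` — `q ∈ (univ.erase j).filter (dist (zM q) (zM j) ≤ Rm)` iff `inRange c P (nN m (μ q) (t q))` (injectivity of the supercell
  motif from `PerSep`, `dist_zM`); `cast_sumX` / `sum_ite_inRange` — hand-1-shaped sums `Σ_{m′} sumBelow … K³` equal sums over the local set;
* §2 per-bond identities: squared distance `Q = n/DEN²`, `V_LJ = vT`, `Ṽ' = dvT`, bond coordinates `(zM j − zM q)_a = −z_a/DEN`;
* §3 ★ `not_removalUnstableCore_of_check`.
The move test is `…CellKitXMove`.  All `[folklore]`; 0 sorry.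
-/

noncomputable section

namespace Summit.AtomisticToContinuum.Crystallization.Theorems.FrustratedLawDichotomyCellKitX

open scoped BigOperators RealInnerProductSpace
open Literature.Geometry.DiscreteGeometry (intVec sqNormInt intVec_apply)
open Literature.MathematicalPhysics.StatisticalMechanics (lennardJones)
open Summit.AtomisticToContinuum.Crystallization.Theorems.ChargedEnergyGapNegative (E3)
open Summit.AtomisticToContinuum.Crystallization.Theorems.FrustratedLawDichotomyCellChecker
  (Cell roundUp le_roundUp allBelow sumBelow allBelow_spec sumBelow_eq)
open Summit.AtomisticToContinuum.Crystallization.Theorems.FrustratedLawDichotomyCellKitF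
  (cellμ cellσ cellIdx cellMid cellμσ_injective sum_cell_eq cellIdx_spec)
open Summit.AtomisticToContinuum.Crystallization.Theorems.FrustratedLawDichotomyCellKitW (qpt qpt_sub)
open Summit.AtomisticToContinuum.Crystallization.Theorems.FrustratedLawDichotomyPeriodicBlockKernel (superMotif_injective)
open Summit.AtomisticToContinuum.Crystallization.Theorems.FrustratedLawDichotomyExemptLocalSharp (tailConstSharp)
open Summit.AtomisticToContinuum.Crystallization.Theorems.FrustratedLawDichotomyExemptAbsorptionRecord (RemovalUnstableCore)
open Summit.AtomisticToContinuum.Crystallization.Theorems.FrustratedLawDichotomyCollarNonExempt (lennardJones_dist_eq_sq)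

variable (c : Cell)

/-! ## §1. The local set and the sum bridge -/

/-- The squared numerator distance of the supercell point `q` to the class centre `m` (abbreviation). -/
abbrev nq (m : Fin c.N₀) (q : Fin (c.N₀ * c.K3)) : ℤ := c.nN m (cellμ c.N₀ c.k₀ q) (finProdFinEquiv.symm q).2

/-- The class centre has numerator distance `0` to itself. [folklore] -/
theorem nq_cellIdx (hD : 0 < c.DEN) (m : Fin c.N₀) : nq c m (cellIdx c.N₀ c.k₀ m) = 0 := by
  have h := c.dist_zM hD m (cellIdx c.N₀ c.k₀ m)
  rw [dist_self] at h
  have hD' : (0 : ℝ) < c.DEN := by exact_mod_cast hD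
  have hs : Real.sqrt (nq c m (cellIdx c.N₀ c.k₀ m) : ℝ) = 0 := by
    have := mul_eq_zero.1 h.symm
    rcases this with h1 | h1
    · exact absurd h1 (inv_ne_zero hD'.ne')
    · exact h1
  have hnn : (0 : ℝ) ≤ (nq c m (cellIdx c.N₀ c.k₀ m) : ℝ) := by exact_mod_cast c.nN_nonneg _ _ _
  have := (Real.sqrt_eq_zero hnn).1 hs
  exact_mod_cast this

/-- ★ **The local set of the exemption predicates is the in-range set of the checker**: for `0 ≤ Rm`,
`q ∈ (univ.erase j).filter (dist (zM q) (zM j) ≤ Rm) ↔ inRange c P (n_q) = true` (`j = cellIdx m`). [folklore] -/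
theorem mem_localSet_iff (hD : 0 < c.DEN) (hsep : FrustratedLawDichotomyPeriodicBlockKernel.PerSep c.x c.a) (P : XParams) (hRm : 0 ≤ P.Rm)
    (m : Fin c.N₀) (q : Fin (c.N₀ * c.K3)) :
    q ∈ (Finset.univ.erase (cellIdx c.N₀ c.k₀ m)).filter (fun k => dist (c.zM k) (c.zM (cellIdx c.N₀ c.k₀ m)) ≤ (P.Rm : ℝ)) ↔
      inRange c P (nq c m q) = true := by
  have hD' : (0 : ℝ) < c.DEN := by exact_mod_cast hD
  have hnn : (0 : ℝ) ≤ (nq c m q : ℝ) := by exact_mod_cast c.nN_nonneg _ _ _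
  rw [Finset.mem_filter, Finset.mem_erase, inRange, Bool.and_eq_true, decide_eq_true_eq, decide_eq_true_eq, c.dist_zM hD m q]
  simp only [Finset.mem_univ, and_true]
  constructor
  · rintro ⟨hne, hle⟩
    refine ⟨?_, ?_⟩
    · have hinj := superMotif_injective hsep (cellμσ_injective c.N₀ c.k₀)
      have hne' : c.zM q ≠ c.zM (cellIdx c.N₀ c.k₀ m) := fun h => hne (hinj h)
      have h0 := c.nN_ne_zero_of_ne hD hne'
      exact lt_of_le_of_ne (c.nN_nonneg _ _ _) (Ne.symm h0)
    · have h1 : Real.sqrt (nq c m q : ℝ) ≤ P.Rm * c.DEN := by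
        rw [inv_mul_le_iff₀ hD'] at hle; linarith
      have h2 : (nq c m q : ℝ) ≤ (P.Rm * c.DEN) ^ 2 := by
        rw [← Real.sq_sqrt hnn]; exact pow_le_pow_left₀ (Real.sqrt_nonneg _) h1 2
      have h3 : ((nq c m q : ℚ) : ℝ) ≤ ((P.Rm ^ 2 * (c.DEN : ℚ) ^ 2 : ℚ) : ℝ) := by push_cast; nlinarith
      exact_mod_cast h3
  · rintro ⟨hpos, hle⟩
    refine ⟨?_, ?_⟩
    · intro hq
      rw [hq, nq_cellIdx c hD m] at hpos
      exact lt_irrefl _ hpos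
    · have h3 : (nq c m q : ℝ) ≤ (P.Rm : ℝ) ^ 2 * (c.DEN : ℝ) ^ 2 := by
        have : ((nq c m q : ℚ) : ℝ) ≤ ((P.Rm ^ 2 * (c.DEN : ℚ) ^ 2 : ℚ) : ℝ) := by exact_mod_cast hle
        push_cast at this; exact this
      have h1 : Real.sqrt (nq c m q : ℝ) ≤ P.Rm * c.DEN := by
        rw [← Real.sqrt_sq (by positivity : (0 : ℝ) ≤ P.Rm * c.DEN)]
        exact Real.sqrt_le_sqrt (by nlinarith)
      rw [inv_mul_le_iff₀ hD']; linarith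

/-- **Sum bridge**: a hand-1-shaped sum is the sum of its summand over the supercell. [folklore] -/
theorem cast_sumX (f : Fin c.N₀ → ℕ → ℚ) :
    ((sumX c f : ℚ) : ℝ) = ∑ q : Fin (c.N₀ * c.K3), (f (cellμ c.N₀ c.k₀ q) (finProdFinEquiv.symm q).2 : ℝ) := by
  unfold sumX
  rw [sum_cell_eq c.N₀ c.k₀ (fun m' (t : Fin ((2 * c.k₀ + 1) ^ 3)) => (f m' t : ℝ))]
  push_cast
  refine Finset.sum_congr rfl fun m' _ => ?_
  rw [sumBelow_eq, ← Fin.sum_univ_eq_sum_range]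
  push_cast
  rfl

/-- ★ **Sums of in-range terms are sums over the local set**: for a summand `if inRange n then v else 0`. [folklore] -/
theorem sum_ite_inRange (hD : 0 < c.DEN) (hsep : FrustratedLawDichotomyPeriodicBlockKernel.PerSep c.x c.a) (P : XParams) (hRm : 0 ≤ P.Rm)
    (m : Fin c.N₀) (v : Fin (c.N₀ * c.K3) → ℝ) :
    (∑ q : Fin (c.N₀ * c.K3), if inRange c P (nq c m q) then v q else 0) =
      ∑ q ∈ (Finset.univ.erase (cellIdx c.N₀ c.k₀ m)).filter (fun k => dist (c.zM k) (c.zM (cellIdx c.N₀ c.k₀ m)) ≤ (P.Rm : ℝ)), v q := by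
  rw [← Finset.sum_filter]
  refine Finset.sum_congr ?_ fun _ _ => rfl
  ext q
  rw [Finset.mem_filter, mem_localSet_iff c hD hsep P hRm m q]
  simp

/-! ## §2. Per-bond identities -/

/-- The squared bond length is `n/DEN²`. [folklore] -/
theorem sq_dist_eq (hD : 0 < c.DEN) (m : Fin c.N₀) (q : Fin (c.N₀ * c.K3)) :
    dist (c.zM (cellIdx c.N₀ c.k₀ m)) (c.zM q) ^ 2 = (nq c m q : ℝ) / (c.DEN : ℝ) ^ 2 := by
  have hD' : (0 : ℝ) < c.DEN := by exact_mod_cast hD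
  have hnn : (0 : ℝ) ≤ (nq c m q : ℝ) := by exact_mod_cast c.nN_nonneg _ _ _
  rw [dist_comm, c.dist_zM hD m q, mul_pow, Real.sq_sqrt hnn, inv_pow]
  field_simp

/-- In range, `n.toNat = n` as a real. [folklore] -/
theorem cast_toNat_of_inRange {P : XParams} {m : Fin c.N₀} {q : Fin (c.N₀ * c.K3)} (h : inRange c P (nq c m q) = true) :
    (((nq c m q).toNat : ℕ) : ℝ) = (nq c m q : ℝ) ∧ 0 < (nq c m q : ℝ) := by
  rw [inRange, Bool.and_eq_true, decide_eq_true_eq] at h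
  have h0 : 0 < nq c m q := h.1
  refine ⟨?_, by exact_mod_cast h0⟩
  have := Int.toNat_of_nonneg h0.le
  exact_mod_cast this

/-- `V_LJ` of an in-range bond is the exact rational `vT DEN n`. [folklore] -/
theorem lennardJones_eq_vT (hD : 0 < c.DEN) {P : XParams} {m : Fin c.N₀} {q : Fin (c.N₀ * c.K3)} (h : inRange c P (nq c m q) = true) :
    lennardJones (dist (c.zM (cellIdx c.N₀ c.k₀ m)) (c.zM q)) = (vT c.DEN (nq c m q).toNat : ℝ) := by
  obtain ⟨hc, hpos⟩ := cast_toNat_of_inRange c h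
  have hD' : (0 : ℝ) < c.DEN := by exact_mod_cast hD
  rw [lennardJones_dist_eq_sq, sq_dist_eq c hD, vT]
  push_cast
  rw [hc, inv_div]

/-- `Ṽ'` of an in-range bond is the exact rational `dvT DEN n`. [folklore] -/
theorem dV_eq_dvT (hD : 0 < c.DEN) {P : XParams} {m : Fin c.N₀} {q : Fin (c.N₀ * c.K3)} (h : inRange c P (nq c m q) = true) :
    -(1 / 2) * (dist (c.zM (cellIdx c.N₀ c.k₀ m)) (c.zM q) ^ 2)⁻¹ ^ 7 + (1 / 2) * (dist (c.zM (cellIdx c.N₀ c.k₀ m)) (c.zM q) ^ 2)⁻¹ ^ 4 =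
      (dvT c.DEN (nq c m q).toNat : ℝ) := by
  obtain ⟨hc, hpos⟩ := cast_toNat_of_inRange c h
  rw [sq_dist_eq c hD, dvT]
  push_cast
  rw [hc, inv_div]

/-- Bond coordinates: `(zM j − zM q)_a = −z_a/DEN` with `z = ptN − X m`. [folklore] -/
theorem bond_coord (m : Fin c.N₀) (q : Fin (c.N₀ * c.K3)) (a : Fin 3) :
    (c.zM (cellIdx c.N₀ c.k₀ m) - c.zM q) a = -((zvec c m (cellμ c.N₀ c.k₀ q) (finProdFinEquiv.symm q).2 a : ℝ)) / c.DEN := by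
  have hq : c.zM q = qpt c.DEN (c.ptN (cellμ c.N₀ c.k₀ q) (finProdFinEquiv.symm q).2) := by
    have := c.zM_pair (cellμ c.N₀ c.k₀ q) (finProdFinEquiv.symm q).2
    rw [show finProdFinEquiv (cellμ c.N₀ c.k₀ q, (finProdFinEquiv.symm q).2) = q by
      rw [show cellμ c.N₀ c.k₀ q = (finProdFinEquiv.symm q).1 from rfl, Prod.mk.eta, Equiv.apply_symm_apply]] at this
    exact this
  rw [hq, c.zM_cellIdx, qpt_sub, qpt, zvec]
  simp [intVec_apply]
  ring

/-! ## §3. The removal test -/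

/-- The rational tail constant is the real one. [folklore] -/
theorem cast_tailQ (D : ℚ) : ((tailQ D : ℚ) : ℝ) = tailConstSharp (D : ℝ) := by
  unfold tailQ tailConstSharp; push_cast; ring

/-- ★ **REMOVAL SOUNDNESS**: `checkParams ∧ checkRemoval m ⟹ ¬RemovalUnstableCore eUp tR Rm` at the class centre `cellIdx m` of the supercell motif
(under the geometry check of hand-1's `…CellChecker`, which supplies `0 < DEN` and `PerSep`). [folklore] -/
theorem not_removalUnstableCore_of_check (hG : c.checkGeom = true) {P : XParams} (hP : checkParams c P = true) {m : Fin c.N₀}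
    (h : checkRemoval c P m = true) :
    ¬ RemovalUnstableCore (P.eUp : ℝ) (P.tR : ℝ) (P.Rm : ℝ) (c.N₀ * c.K3) c.zM (cellIdx c.N₀ c.k₀ m) := by
  obtain ⟨hD, -, hsep, -⟩ := c.geom_sound hG
  simp only [checkParams, Bool.and_eq_true, decide_eq_true_eq] at hP
  obtain ⟨⟨⟨⟨-, hs0⟩, hsRm⟩, -⟩, -⟩ := hP
  have hRm : 0 ≤ P.Rm := (hs0.trans hsRm).le
  rw [checkRemoval, decide_eq_true_eq] at h
  unfold RemovalUnstableCore
  rw [not_lt]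
  have hcast : ((sumX c (termV c P m) : ℚ) : ℝ) ≤ P.eUp + P.tR + tailConstSharp (P.Rm : ℝ) := by
    rw [← cast_tailQ]; exact_mod_cast h
  refine le_trans ?_ hcast
  rw [cast_sumX]
  -- the summand is the in-range indicator times `roundUp vT`
  have hterm : ∀ q : Fin (c.N₀ * c.K3), ((termV c P m (cellμ c.N₀ c.k₀ q) (finProdFinEquiv.symm q).2 : ℚ) : ℝ) =
      if inRange c P (nq c m q) then ((roundUp (vT c.DEN (nq c m q).toNat) : ℚ) : ℝ) else 0 := by
    intro q; unfold termV nq; split_ifs <;> simp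
  simp_rw [hterm]
  rw [sum_ite_inRange c hD hsep P hRm m]
  refine Finset.sum_le_sum fun q hq => ?_
  have hin := (mem_localSet_iff c hD hsep P hRm m q).1 hq
  rw [lennardJones_eq_vT c hD hin]
  exact_mod_cast le_roundUp _

end Summit.AtomisticToContinuum.Crystallization.Theorems.FrustratedLawDichotomyCellKitX

end
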